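import Mathlib.Data.Nat.Choose.Multinomial
import Mathlib.Algebra.Order.Antidiag.Pi
import Mathlib.Analysis.SpecialFunctions.Log.NegMulLog
import Mathlib.Analysis.SpecialFunctions.Pow.Real
import Mathlib.Analysis.SpecialFunctions.Log.Base
import Literature.Computability.AlgebraicComplexity.QuantumFunctionals
import HarnessLib

/-!
# Multinomial coefficients and entropy: `binom(N; α(1)N, …, α(s)N) = 2^{N (H(α) ± o(1))}`
(Alman–Duan–Vassilevska Williams–Xu–Xu–Zhou 2025, Lemma 3.3; the method of types) — proved

Topic `Literature/Computability/AlgebraicComplexity`.  The "well-known combinatorial fact" used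
throughout the laser method to count variable blocks of a given type (Coppersmith–Winograd 1990 §6;
Alman–Duan–Vassilevska Williams–Xu–Xu–Zhou, SODA 2025 = arXiv:2404.16349, §3.9, **Lemma 3.3**):

> Let `α` be a distribution over `[s]` and `N > 0` an integer (with all `α(i) N` integers). Then
> `binom(N; α(1)N, …, α(s)N) = 2^{N (H(α) ± o(1))}`, `H(α) = -∑ α(i) log₂ α(i)`.

We prove it in the standard quantitative form of the method of types (Cover–Thomas, *Elements of
Information Theory*, "Size of a type class `T(P)`": for every type `P` with denominator `N` over an
alphabet `𝒳`, `(N+1)^{-|𝒳|} 2^{N H(P)} ≤ |T(P)| ≤ 2^{N H(P)}`, where `|T(P)|` is exactly the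
multinomial coefficient), for a count vector `k : ι → ℕ` with `∑ k = N` and its type
`p = k/N : ι → ℝ`:

* `multinomial_le_exp_mul_sum_negMulLog` — `binom(N; k) ≤ exp(N · ∑ᵢ η(kᵢ/N))`, `η(x) = -x log x`
  (`Real.negMulLog`), i.e. `≤ 2^{N H(k/N)}`: `multinomial_le_two_rpow_mul_shannonEntropy`, with
  `H = shannonEntropy` (bits, `QuantumFunctionals.lean`);
* `exp_mul_sum_negMulLog_le_mul_multinomial` — `exp(N · ∑ᵢ η(kᵢ/N)) ≤ (N+1)^{|ι|} · binom(N; k)`,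
  i.e. `2^{N H(k/N)} ≤ (N+1)^{|ι|} binom(N; k)`: `two_rpow_mul_shannonEntropy_le_mul_multinomial`;
* `abs_logb_multinomial_sub_le` — `|log₂ binom(N; k) − N·H(k/N)| ≤ |ι| · log₂ (N+1)`;
* `advxxz2025_lemma33` — the printed `o(1)` form, uniformly in the type: for every `ε > 0` and all
  large `N`, every `k` with `∑ k = N` has `2^{N (H(k/N) − ε)} ≤ binom(N; k) ≤ 2^{N H(k/N)}`.

Ingredients (all proved here): the number of types is `≤ (N+1)^{|ι|}` (`card_piAntidiag_univ_le`);
under the product measure `p^{⊗N}` the type class of `p` itself is the likeliest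
(`typeClassMass_le`, from the integer inequality `a! a^b ≤ b! a^a`,
`factorial_mul_pow_le_factorial_mul_pow`); and the multinomial theorem
(`Finset.sum_pow_eq_sum_piAntidiag`) `∑_{types k'} binom(N;k') ∏ pᵢ^{k'ᵢ} = (∑ pᵢ)^N = 1`.
No new definitions.

## References

* J. Alman, R. Duan, V. Vassilevska Williams, Y. Xu, Z. Xu, R. Zhou, *More asymmetry yields faster
  matrix multiplication*, SODA 2025, 2005–2039 = arXiv:2404.16349, §3.9, Lemma 3.3.
  [AlmanDuanVassilevskaWilliamsXuXuZhou2025]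
* T. M. Cover, J. A. Thomas, *Elements of Information Theory*, Wiley; 2nd ed. (2006) Thm. 11.1.3,
  1st ed. (1991) Thm. 12.1.3, eq. (12.16) ("Size of a type class"), with Thm. 11.1.1/12.1.1
  (`|𝒫_N| ≤ (N+1)^{|𝒳|}`) and the proof of Thm. 11.1.4/12.1.4 (`P^N(T(P)) ≥ P^N(T(P̂))`).
  [CoverThomas2005]
-/

noncomputable section

open scoped BigOperators
open Finset Real

namespace Literature.Computability.AlgebraicComplexity

/-! ## Counting lemmas in `ℕ` -/

/-- `a! · a^b ≤ b! · a^a` for all naturals `a, b` — the inequality `m!/n! ≤ m^{m-n}` of the method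
of types in product form. [cite: CoverThomas2005, Thm. 11.1.4 (proof)] -/
theorem factorial_mul_pow_le_factorial_mul_pow (a b : ℕ) :
    Nat.factorial a * a ^ b ≤ Nat.factorial b * a ^ a := by
  rcases le_total a b with hab | hba
  · calc Nat.factorial a * a ^ b = Nat.factorial a * a ^ (b - a) * a ^ a := by
          rw [mul_assoc, ← pow_add, Nat.sub_add_cancel hab]
      _ ≤ Nat.factorial b * a ^ a :=
          Nat.mul_le_mul_right _ (Nat.factorial_mul_pow_sub_le_factorial hab)
  · have h1 : Nat.factorial (a - (a - b)) * a.descFactorial (a - b) = Nat.factorial a :=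
      Nat.factorial_mul_descFactorial (Nat.sub_le a b)
    rw [Nat.sub_sub_self hba] at h1
    calc Nat.factorial a * a ^ b = Nat.factorial b * a.descFactorial (a - b) * a ^ b := by rw [h1]
      _ ≤ Nat.factorial b * a ^ (a - b) * a ^ b := by
          gcongr
          exact Nat.descFactorial_le_pow _ _
      _ = Nat.factorial b * a ^ a := by
          rw [mul_assoc, ← pow_add, Nat.sub_add_cancel hba]

variable {ι : Type*} [Fintype ι]

/-- Termwise product of `factorial_mul_pow_le_factorial_mul_pow`:
`∏ᵢ kᵢ! kᵢ^{k'ᵢ} ≤ ∏ᵢ k'ᵢ! kᵢ^{kᵢ}`. [cite: CoverThomas2005, Thm. 11.1.4 (proof)] -/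
theorem prod_factorial_mul_pow_le (k k' : ι → ℕ) :
    ∏ i, (Nat.factorial (k i) * k i ^ k' i) ≤ ∏ i, (Nat.factorial (k' i) * k i ^ k i) :=
  prod_le_prod (fun _ _ => Nat.zero_le _) fun i _ => factorial_mul_pow_le_factorial_mul_pow (k i) (k' i)

/-- **There are at most `(N+1)^{|ι|}` types with denominator `N`** (count vectors `k : ι → ℕ` with
`∑ k = N`). [cite: CoverThomas2005, Thm. 11.1.1] -/
theorem card_piAntidiag_univ_le [DecidableEq ι] (N : ℕ) :
    ((univ : Finset ι).piAntidiag N).card ≤ (N + 1) ^ Fintype.card ι := by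
  calc ((univ : Finset ι).piAntidiag N).card
      ≤ (Fintype.piFinset fun _ : ι => range (N + 1)).card := by
        refine card_le_card fun k hk => ?_
        rw [mem_piAntidiag] at hk
        rw [Fintype.mem_piFinset]
        intro i
        rw [mem_range, Nat.lt_succ_iff, ← hk.1]
        exact single_le_sum (fun j _ => Nat.zero_le (k j)) (mem_univ i)
    _ = (N + 1) ^ Fintype.card ι := by
        rw [Fintype.card_piFinset, prod_const, card_range, card_univ]

/-! ## The mass of a type class under the product measure of the type -/

/-- Closed form of the `p^{⊗N}`-mass of the type class of `k'`, `p = k/N`: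
`binom(N; k') ∏ᵢ (kᵢ/N)^{k'ᵢ} = N! ∏ᵢ kᵢ^{k'ᵢ} / (∏ᵢ k'ᵢ! · N^N)`. [cite: CoverThomas2005, Thm. 11.1.4 (proof)] -/
theorem typeClassMass_eq (k k' : ι → ℕ) {N : ℕ} (hk' : ∑ i, k' i = N) :
    (Nat.multinomial univ k' : ℝ) * ∏ i, ((k i : ℝ) / N) ^ k' i =
      (Nat.factorial N : ℝ) * (∏ i, (k i : ℝ) ^ k' i) /
        ((∏ i, (Nat.factorial (k' i) : ℝ)) * (N : ℝ) ^ N) := by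
  have hspec : (∏ i, (Nat.factorial (k' i) : ℝ)) * (Nat.multinomial univ k' : ℝ) = Nat.factorial N := by
    rw [← hk']
    exact_mod_cast Nat.multinomial_spec univ k'
  have hprod : (∏ i, (Nat.factorial (k' i) : ℝ)) ≠ 0 :=
    prod_ne_zero_iff.2 fun i _ => by exact_mod_cast (Nat.factorial_pos _).ne'
  have hmult : (Nat.multinomial univ k' : ℝ) = Nat.factorial N / ∏ i, (Nat.factorial (k' i) : ℝ) := by
    rw [eq_div_iff hprod, mul_comm, hspec]
  have hpow : ∏ i, ((k i : ℝ) / N) ^ k' i = (∏ i, (k i : ℝ) ^ k' i) / (N : ℝ) ^ N := by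
    simp_rw [div_pow]
    rw [prod_div_distrib, prod_pow_eq_pow_sum, hk']
  rw [hmult, hpow, div_mul_div_comm]

/-- **The type class of `p` is the likeliest under `p^{⊗N}`**: for types `k, k'` with the same
denominator `N`, `binom(N; k') ∏ᵢ (kᵢ/N)^{k'ᵢ} ≤ binom(N; k) ∏ᵢ (kᵢ/N)^{kᵢ}`.
[cite: CoverThomas2005, Thm. 11.1.4] -/
theorem typeClassMass_le (k k' : ι → ℕ) {N : ℕ} (hk : ∑ i, k i = N) (hk' : ∑ i, k' i = N) :
    (Nat.multinomial univ k' : ℝ) * ∏ i, ((k i : ℝ) / N) ^ k' i ≤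
      (Nat.multinomial univ k : ℝ) * ∏ i, ((k i : ℝ) / N) ^ k i := by
  rw [typeClassMass_eq k k' hk', typeClassMass_eq k k hk]
  have hD : ∀ f : ι → ℕ, (0 : ℝ) < (∏ i, (Nat.factorial (f i) : ℝ)) := fun f =>
    prod_pos fun i _ => by exact_mod_cast Nat.factorial_pos _
  rcases Nat.eq_zero_or_pos N with rfl | hN
  · -- `N = 0`: both types are `0`
    have h0 : ∀ f : ι → ℕ, ∑ i, f i = 0 → f = 0 := fun f hf =>
      funext fun i => (sum_eq_zero_iff.1 hf) i (mem_univ i)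
    rw [h0 k hk, h0 k' hk']
  have hNN : (0 : ℝ) < (N : ℝ) ^ N := by positivity
  rw [div_le_div_iff₀ (mul_pos (hD k') hNN) (mul_pos (hD k) hNN)]
  -- reduce to the integer inequality `∏ kᵢ! kᵢ^{k'ᵢ} ≤ ∏ k'ᵢ! kᵢ^{kᵢ}`
  have hnat : (∏ i, (k i : ℝ) ^ k' i) * ∏ i, (Nat.factorial (k i) : ℝ) ≤
      (∏ i, (k i : ℝ) ^ k i) * ∏ i, (Nat.factorial (k' i) : ℝ) := by
    have := prod_factorial_mul_pow_le k k'
    rw [prod_mul_distrib, prod_mul_distrib] at this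
    have h' : ((∏ i, Nat.factorial (k i)) * (∏ i, k i ^ k' i) : ℕ) ≤
        (∏ i, Nat.factorial (k' i)) * (∏ i, k i ^ k i) := this
    have h'' : (((∏ i, Nat.factorial (k i)) * (∏ i, k i ^ k' i) : ℕ) : ℝ) ≤
        (((∏ i, Nat.factorial (k' i)) * (∏ i, k i ^ k i) : ℕ) : ℝ) := by exact_mod_cast h'
    push_cast at h''
    linarith [h'']
  calc (Nat.factorial N : ℝ) * (∏ i, (k i : ℝ) ^ k' i) * ((∏ i, (Nat.factorial (k i) : ℝ)) * (N : ℝ) ^ N)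
      = ((Nat.factorial N : ℝ) * (N : ℝ) ^ N) * ((∏ i, (k i : ℝ) ^ k' i) * ∏ i, (Nat.factorial (k i) : ℝ)) := by
        ring
    _ ≤ ((Nat.factorial N : ℝ) * (N : ℝ) ^ N) * ((∏ i, (k i : ℝ) ^ k i) * ∏ i, (Nat.factorial (k' i) : ℝ)) :=
        mul_le_mul_of_nonneg_left hnat (by positivity)
    _ = (Nat.factorial N : ℝ) * (∏ i, (k i : ℝ) ^ k i) * ((∏ i, (Nat.factorial (k' i) : ℝ)) * (N : ℝ) ^ N) := by
        ring

/-- The multinomial theorem for the type `p = k/N`: the masses of all type classes add up to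
`(∑ᵢ kᵢ/N)^N = 1`. [cite: CoverThomas2005, Thm. 11.1.4 (proof)] -/
theorem sum_typeClassMass_eq_one [DecidableEq ι] (k : ι → ℕ) {N : ℕ} (hk : ∑ i, k i = N) (hN : N ≠ 0) :
    ∑ k' ∈ (univ : Finset ι).piAntidiag N,
      (Nat.multinomial univ k' : ℝ) * ∏ i, ((k i : ℝ) / N) ^ k' i = 1 := by
  have h := (sum_pow_eq_sum_piAntidiag (univ : Finset ι) (fun i => (k i : ℝ) / N) N).symm
  rw [h, ← sum_div, ← Nat.cast_sum, hk, div_self (by exact_mod_cast hN), one_pow]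

/-- Each type-class mass is nonnegative. [folklore] -/
theorem typeClassMass_nonneg (k k' : ι → ℕ) (N : ℕ) :
    0 ≤ (Nat.multinomial univ k' : ℝ) * ∏ i, ((k i : ℝ) / N) ^ k' i :=
  mul_nonneg (Nat.cast_nonneg _) (prod_nonneg fun i _ => by positivity)

/-- **Upper bound**: `binom(N; k) · ∏ᵢ (kᵢ/N)^{kᵢ} ≤ 1`. [cite: CoverThomas2005, Thm. 11.1.3 (proof)] -/
theorem typeClassMass_self_le_one (k : ι → ℕ) {N : ℕ} (hk : ∑ i, k i = N) :
    (Nat.multinomial univ k : ℝ) * ∏ i, ((k i : ℝ) / N) ^ k i ≤ 1 := by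
  classical
  rcases Nat.eq_zero_or_pos N with rfl | hN
  · have h0 : k = 0 := funext fun i => (sum_eq_zero_iff.1 hk) i (mem_univ i)
    subst h0
    have : (Nat.multinomial (univ : Finset ι) (0 : ι → ℕ) : ℝ) = 1 := by
      have h := Nat.multinomial_spec (univ : Finset ι) (0 : ι → ℕ)
      simp only [Pi.zero_apply, Nat.factorial_zero, prod_const_one, one_mul, sum_const_zero] at h
      exact_mod_cast h
    simp [this]
  rw [← sum_typeClassMass_eq_one k hk hN.ne']
  have hmem : k ∈ (univ : Finset ι).piAntidiag N := by
    rw [mem_piAntidiag]; exact ⟨hk, fun i _ => mem_univ i⟩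
  exact single_le_sum (f := fun k' => (Nat.multinomial univ k' : ℝ) * ∏ i, ((k i : ℝ) / N) ^ k' i)
    (fun k' _ => typeClassMass_nonneg k k' N) hmem

/-- **Lower bound**: `1 ≤ (N+1)^{|ι|} · binom(N; k) · ∏ᵢ (kᵢ/N)^{kᵢ}` (at most `(N+1)^{|ι|}` type
classes, each of mass at most that of the type class of `k/N`). [cite: CoverThomas2005, Thm. 11.1.3 (proof)] -/
theorem one_le_card_pow_mul_typeClassMass_self (k : ι → ℕ) {N : ℕ} (hk : ∑ i, k i = N) :
    1 ≤ ((N : ℝ) + 1) ^ Fintype.card ι *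
      ((Nat.multinomial univ k : ℝ) * ∏ i, ((k i : ℝ) / N) ^ k i) := by
  classical
  rcases Nat.eq_zero_or_pos N with rfl | hN
  · have h0 : k = 0 := funext fun i => (sum_eq_zero_iff.1 hk) i (mem_univ i)
    subst h0
    have : (Nat.multinomial (univ : Finset ι) (0 : ι → ℕ) : ℝ) = 1 := by
      have h := Nat.multinomial_spec (univ : Finset ι) (0 : ι → ℕ)
      simp only [Pi.zero_apply, Nat.factorial_zero, prod_const_one, one_mul, sum_const_zero] at h
      exact_mod_cast h
    simp [this]
  calc (1 : ℝ) = ∑ k' ∈ (univ : Finset ι).piAntidiag N,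
        (Nat.multinomial univ k' : ℝ) * ∏ i, ((k i : ℝ) / N) ^ k' i :=
        (sum_typeClassMass_eq_one k hk hN.ne').symm
    _ ≤ ∑ _k' ∈ (univ : Finset ι).piAntidiag N,
        (Nat.multinomial univ k : ℝ) * ∏ i, ((k i : ℝ) / N) ^ k i :=
        sum_le_sum fun k' hk' => typeClassMass_le k k' hk (mem_piAntidiag.1 hk').1
    _ = ((univ : Finset ι).piAntidiag N).card *
        ((Nat.multinomial univ k : ℝ) * ∏ i, ((k i : ℝ) / N) ^ k i) := by
        rw [sum_const, nsmul_eq_mul]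
    _ ≤ ((N : ℝ) + 1) ^ Fintype.card ι *
        ((Nat.multinomial univ k : ℝ) * ∏ i, ((k i : ℝ) / N) ^ k i) := by
        refine mul_le_mul_of_nonneg_right ?_ (typeClassMass_nonneg k k N)
        exact_mod_cast card_piAntidiag_univ_le (ι := ι) N

/-! ## Entropy forms -/

/-- `∏ᵢ (kᵢ/N)^{kᵢ} = exp(−N · ∑ᵢ η(kᵢ/N))` with `η(x) = -x log x`: the mass of a sequence of type
`p` under `p^{⊗N}` is `2^{-N H(p)}`. [cite: CoverThomas2005, Thm. 11.1.2] -/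
theorem prod_div_pow_eq_exp_neg (k : ι → ℕ) {N : ℕ} (hk : ∑ i, k i = N) :
    ∏ i, ((k i : ℝ) / N) ^ k i = Real.exp (-(N * ∑ i, negMulLog ((k i : ℝ) / N))) := by
  rcases Nat.eq_zero_or_pos N with rfl | hN
  · have h0 : k = 0 := funext fun i => (sum_eq_zero_iff.1 hk) i (mem_univ i)
    subst h0
    simp
  have hN' : (N : ℝ) ≠ 0 := by exact_mod_cast hN.ne'
  rw [mul_sum, ← sum_neg_distrib, Real.exp_sum]
  refine prod_congr rfl fun i _ => ?_
  have hterm : -((N : ℝ) * negMulLog ((k i : ℝ) / N)) = (k i : ℝ) * Real.log ((k i : ℝ) / N) := by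
    simp only [negMulLog, neg_mul, mul_neg, neg_neg]
    rw [← mul_assoc, mul_div_cancel₀ _ hN']
  rw [hterm]
  rcases Nat.eq_zero_or_pos (k i) with hki | hki
  · simp [hki]
  · have hpos : (0 : ℝ) < (k i : ℝ) / N := by positivity
    rw [← Real.log_pow, Real.exp_log (pow_pos hpos _)]

/-- **Method of types, upper bound (nats)**: `binom(N; k) ≤ exp(N · ∑ᵢ η(kᵢ/N))`.
[cite: CoverThomas2005, Thm. 11.1.3] -/
theorem multinomial_le_exp_mul_sum_negMulLog (k : ι → ℕ) {N : ℕ} (hk : ∑ i, k i = N) :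
    (Nat.multinomial univ k : ℝ) ≤ Real.exp (N * ∑ i, negMulLog ((k i : ℝ) / N)) := by
  have h := typeClassMass_self_le_one k hk
  rw [prod_div_pow_eq_exp_neg k hk, Real.exp_neg, ← div_eq_mul_inv,
    div_le_one (Real.exp_pos _)] at h
  exact h

/-- **Method of types, lower bound (nats)**: `exp(N · ∑ᵢ η(kᵢ/N)) ≤ (N+1)^{|ι|} · binom(N; k)`.
[cite: CoverThomas2005, Thm. 11.1.3] -/
theorem exp_mul_sum_negMulLog_le_mul_multinomial (k : ι → ℕ) {N : ℕ} (hk : ∑ i, k i = N) :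
    Real.exp (N * ∑ i, negMulLog ((k i : ℝ) / N)) ≤
      ((N : ℝ) + 1) ^ Fintype.card ι * Nat.multinomial univ k := by
  have h := one_le_card_pow_mul_typeClassMass_self k hk
  rw [prod_div_pow_eq_exp_neg k hk, Real.exp_neg, ← mul_assoc, ← div_eq_mul_inv,
    one_le_div (Real.exp_pos _)] at h
  exact h

/-- `2^{N · H(p)} = exp(N · ∑ η(pᵢ))` for the entropy in bits `H = shannonEntropy`. [folklore] -/
theorem two_rpow_mul_shannonEntropy (p : ι → ℝ) (c : ℝ) :
    (2 : ℝ) ^ (c * shannonEntropy p) = Real.exp (c * ∑ i, negMulLog (p i)) := by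
  rw [Real.rpow_def_of_pos (by norm_num : (0 : ℝ) < 2), shannonEntropy_def]
  congr 1
  have h2 : Real.log 2 ≠ 0 := (Real.log_pos one_lt_two).ne'
  field_simp

/-- **ADVXXZ Lemma 3.3, upper half**: `binom(N; k) ≤ 2^{N · H(k/N)}` (entropy in bits).
[cite: AlmanDuanVassilevskaWilliamsXuXuZhou2025, Lemma 3.3] -/
theorem multinomial_le_two_rpow_mul_shannonEntropy (k : ι → ℕ) {N : ℕ} (hk : ∑ i, k i = N) :
    (Nat.multinomial univ k : ℝ) ≤ (2 : ℝ) ^ ((N : ℝ) * shannonEntropy fun i => (k i : ℝ) / N) := by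
  rw [two_rpow_mul_shannonEntropy]
  exact multinomial_le_exp_mul_sum_negMulLog k hk

/-- **ADVXXZ Lemma 3.3, lower half**: `2^{N · H(k/N)} ≤ (N+1)^{|ι|} · binom(N; k)`.
[cite: AlmanDuanVassilevskaWilliamsXuXuZhou2025, Lemma 3.3] -/
theorem two_rpow_mul_shannonEntropy_le_mul_multinomial (k : ι → ℕ) {N : ℕ} (hk : ∑ i, k i = N) :
    (2 : ℝ) ^ ((N : ℝ) * shannonEntropy fun i => (k i : ℝ) / N) ≤
      ((N : ℝ) + 1) ^ Fintype.card ι * Nat.multinomial univ k := by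
  rw [two_rpow_mul_shannonEntropy]
  exact exp_mul_sum_negMulLog_le_mul_multinomial k hk

/-- **ADVXXZ Lemma 3.3, logarithmic form**: `|log₂ binom(N; k) − N · H(k/N)| ≤ |ι| · log₂ (N+1)`.
[cite: AlmanDuanVassilevskaWilliamsXuXuZhou2025, Lemma 3.3] -/
theorem abs_logb_multinomial_sub_le (k : ι → ℕ) {N : ℕ} (hk : ∑ i, k i = N) :
    |Real.logb 2 (Nat.multinomial univ k) - N * shannonEntropy (fun i => (k i : ℝ) / N)| ≤
      Fintype.card ι * Real.logb 2 ((N : ℝ) + 1) := by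
  have hm : (0 : ℝ) < Nat.multinomial univ k := by exact_mod_cast Nat.multinomial_pos _ _
  have hN1 : (0 : ℝ) < (N : ℝ) + 1 := by positivity
  have hup := multinomial_le_two_rpow_mul_shannonEntropy k hk
  have hlo := two_rpow_mul_shannonEntropy_le_mul_multinomial k hk
  -- take `log₂`
  have h1 : Real.logb 2 (Nat.multinomial univ k) ≤ N * shannonEntropy (fun i => (k i : ℝ) / N) := by
    have := Real.logb_le_logb_of_le (b := 2) one_lt_two hm hup
    rwa [Real.logb_rpow two_pos (by norm_num)] at this
  have h2 : N * shannonEntropy (fun i => (k i : ℝ) / N) ≤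
      Fintype.card ι * Real.logb 2 ((N : ℝ) + 1) + Real.logb 2 (Nat.multinomial univ k) := by
    have := Real.logb_le_logb_of_le (b := 2) one_lt_two (Real.rpow_pos_of_pos two_pos _) hlo
    rwa [Real.logb_rpow two_pos (by norm_num), Real.logb_mul (pow_pos hN1 _).ne' hm.ne',
      Real.logb_pow] at this
  rw [abs_le]
  constructor <;> nlinarith [Real.logb_nonneg (b := 2) one_lt_two (le_add_of_nonneg_left (Nat.cast_nonneg N) : (1:ℝ) ≤ N + 1)]

/-- **ADVXXZ Lemma 3.3** (`binom(N; α(1)N, …, α(s)N) = 2^{N (H(α) ± o(1))}`), as a statement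
uniform in the type: for every `ε > 0` there is `N₀` such that for all `N ≥ N₀` and every count
vector `k : ι → ℕ` with `∑ k = N`, `2^{N (H(k/N) − ε)} ≤ binom(N; k) ≤ 2^{N · H(k/N)}`.
[cite: AlmanDuanVassilevskaWilliamsXuXuZhou2025, Lemma 3.3] -/
theorem advxxz2025_lemma33 (ι : Type*) [Fintype ι] {ε : ℝ} (hε : 0 < ε) :
    ∃ N₀ : ℕ, ∀ N : ℕ, N₀ ≤ N → ∀ k : ι → ℕ, ∑ i, k i = N →
      (2 : ℝ) ^ ((N : ℝ) * (shannonEntropy (fun i => (k i : ℝ) / N) - ε)) ≤ Nat.multinomial univ k ∧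
      (Nat.multinomial univ k : ℝ) ≤ (2 : ℝ) ^ ((N : ℝ) * shannonEntropy fun i => (k i : ℝ) / N) := by
  -- `|ι| log₂ (N+1) ≤ ε N` for large `N`, from `log x = o(x)`
  set s : ℕ := Fintype.card ι with hs
  have hlog : ∀ᶠ N : ℕ in Filter.atTop, (s : ℝ) * Real.logb 2 ((N : ℝ) + 1) ≤ ε * N := by
    have ho := Real.isLittleO_log_id_atTop
    have ht : Filter.Tendsto (fun N : ℕ => (N : ℝ) + 1) Filter.atTop Filter.atTop :=
      Filter.tendsto_atTop_add_const_right _ 1 tendsto_natCast_atTop_atTop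
    have ho' := ho.comp_tendsto ht
    have hc : 0 < ε * Real.log 2 / (2 * (s + 1)) := by
      have := Real.log_pos one_lt_two; positivity
    have hev := ho'.def hc
    filter_upwards [hev, Filter.eventually_ge_atTop 1] with N hN hN1
    simp only [Function.comp, id, Real.norm_eq_abs] at hN
    have hlogN : 0 ≤ Real.log ((N : ℝ) + 1) := Real.log_nonneg (by linarith [(Nat.one_le_cast.2 hN1 : (1:ℝ) ≤ N)])
    rw [abs_of_nonneg hlogN, abs_of_nonneg (by positivity)] at hN
    have hl2 : 0 < Real.log 2 := Real.log_pos one_lt_two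
    rw [Real.logb, div_eq_mul_inv]
    have hN1' : (1 : ℝ) ≤ N := Nat.one_le_cast.2 hN1
    -- `s log(N+1) ≤ s · c (N+1) ≤ ε log 2 · N` with `c = ε log 2 / (2(s+1))`
    have key : (s : ℝ) * Real.log ((N : ℝ) + 1) ≤ ε * N * Real.log 2 := by
      calc (s : ℝ) * Real.log ((N : ℝ) + 1) ≤ (s : ℝ) * (ε * Real.log 2 / (2 * (s + 1)) * ((N : ℝ) + 1)) :=
            mul_le_mul_of_nonneg_left hN (Nat.cast_nonneg _)
        _ = (s / (s + 1)) * (ε * Real.log 2) * (((N : ℝ) + 1) / 2) := by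
            field_simp
        _ ≤ 1 * (ε * Real.log 2) * N := by
            have hA : (s : ℝ) / (s + 1) ≤ 1 := by rw [div_le_one (by positivity)]; linarith
            have hB : ((N : ℝ) + 1) / 2 ≤ N := by linarith
            have hE : 0 ≤ ε * Real.log 2 := mul_nonneg hε.le hl2.le
            exact mul_le_mul (mul_le_mul_of_nonneg_right hA hE) hB (by positivity) (by positivity)
        _ = ε * N * Real.log 2 := by ring
    calc (s : ℝ) * (Real.log ((N : ℝ) + 1) * (Real.log 2)⁻¹)
        = ((s : ℝ) * Real.log ((N : ℝ) + 1)) / Real.log 2 := by ring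
      _ ≤ (ε * N * Real.log 2) / Real.log 2 := div_le_div_of_nonneg_right key hl2.le
      _ = ε * N := by field_simp
  obtain ⟨N₀, hN₀⟩ := Filter.eventually_atTop.1 hlog
  refine ⟨N₀, fun N hN k hk => ⟨?_, multinomial_le_two_rpow_mul_shannonEntropy k hk⟩⟩
  have habs := abs_logb_multinomial_sub_le k hk
  have hm : (0 : ℝ) < Nat.multinomial univ k := by exact_mod_cast Nat.multinomial_pos _ _
  have hle : (N : ℝ) * (shannonEntropy (fun i => (k i : ℝ) / N) - ε) ≤
      Real.logb 2 (Nat.multinomial univ k) := by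
    have := (abs_le.1 habs).1
    have := hN₀ N hN
    nlinarith
  calc (2 : ℝ) ^ ((N : ℝ) * (shannonEntropy (fun i => (k i : ℝ) / N) - ε))
      ≤ (2 : ℝ) ^ Real.logb 2 (Nat.multinomial univ k) :=
        Real.rpow_le_rpow_of_exponent_le one_le_two hle
    _ = Nat.multinomial univ k := Real.rpow_logb two_pos (by norm_num) hm

end Literature.Computability.AlgebraicComplexity

end
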